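import Literature.NumberTheory.Sieve.CubicBoxModelClassSums
import Literature.NumberTheory.Sieve.RoughModelVarianceExpansion
import Literature.NumberTheory.Sieve.RoughModelDispersionTailSums
import HarnessLib

/-!
# Residue-class bounds for the Heath-Brown weight and its box model, by ranges of the modulus, PROVED

Topic `Literature/NumberTheory/Sieve`, namespace `Literature.NumberTheory.Sieve.CubicMinorant`
(continuation of `CubicBoxModelClassSums.lean`, `CubicFormClassCountBounds.lean`,
`HeathBrownWeightClassSums.lean`).

In the main part `N κ_z ∑_{t ⊆ S'} a_t Z(2∏t)` of the dispersion for `n = p + (x³+2y³)`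
(`sum_sum_mul_pairSingSeries_eq`; parity-ideate route `GoldbachHeathBrownDispersion`, crux
ModelDispersion), `Z(m) = ∑_{r<m} (A_r(m) − B_r(m))²` with the class sums `A_r(m) = ∑_{k ≤ N, k≡r (m)} f₃(k)`
of the Heath-Brown weight and `B_r(m)` of its box model `ũ`.  We PROVE the per-modulus / per-class
bounds used in the three ranges of `m = 2∏_{p∈t} p` [BombieriFriedlanderIwaniecActa1986, §3;
HalberstamRichert1974, Thm 2.2 / Thm 2.5; HeathBrownMoroz2004, §3 (3.1)–(3.3)]:

* `classVariance_le_of_close` — SMALL moduli: if `|A_r − ρ_r U| ≤ M` and `|B_r − ρ_r U| ≤ εU` for all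
  `r < m` then `Z(m) ≤ m (2M² + 2ε²U²)`; `card_powerset_filter_two_mul_prod_le` — there are at most `Q`
  sets `t` of primes with `2∏t ≤ Q`.
* `sum_hbWeight_modEq_le_mid`, `sum_boxModel_modEq_le_mid` — MIDDLE moduli (`m² ≤ L`, class sieve
  available): `A_r(m) ≤ (96 C_BT/κ) U 6^{|t|+1}/m` (Brun–Titchmarsh for the class sums, the log saved by
  `log(L/m) ≥ (log N)/24`) and `B_r(m) ≤ 4U 6^{|t|+1}/m` (Fundamental Lemma in ratio form for the
  admissible classes, `V_m ≤ 2^{ω(m)} V`, `R ≥ L²V/2`).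
* `sum_hbWeight_modEq_le_crude`, `sum_boxModel_modEq_le_crude` — LARGE moduli: the cube-root count
  `#{box pairs : x³+2y³ ≡ r (m)} ≤ L 3^{|t|+1}(L/m + 1)`.
* `prod_inv_sub_two_mul_le`, `sum_powerset_prod_three_div_le` — the arithmetic of the weights
  `a_t = ∏_{p∈t}(p−2)⁻¹`: `a_t 6^{|t|+1}/(2∏t) ≤ 3∏_{p∈t} 18/p²` and `∑_{t⊆S'} a_t 3^{|t|} ≤ z³`.

No new facts. Written for the parity-ideate cell (literature seat g14, 2026-08-27).

## References

* [BombieriFriedlanderIwaniecActa1986] Bombieri–Friedlander–Iwaniec, Acta Math. 156 (1986), §3.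
* [HalberstamRichert1974] H. Halberstam, H.-E. Richert, *Sieve Methods*, Thm 2.2, Thm 2.5, Ch. 2 §2.
* [HeathBrownMoroz2004] D. R. Heath-Brown, B. Z. Moroz, Proc. LMS (3) 88 (2004), §3 (3.1)–(3.3).
-/

noncomputable section

open Finset Filter
open Literature.NumberTheory.Sieve Literature.NumberTheory.Sieve.CubicPrimes

namespace Literature.NumberTheory.Sieve.CubicMinorant

/-! ### Small moduli: both class distributions close to the local density -/

/-- **Small moduli**: if `|∑_{k≡r} u − ρ_r U| ≤ M` and `|∑_{k≡r} v − ρ_r U| ≤ εU` for all `r < m`, then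
`∑_{r<m} (∑_{k≡r}(u − v))² ≤ m(2M² + 2ε²U²)`.
[cite: BombieriFriedlanderIwaniecActa1986, §3 (the dispersion method: collecting residue classes)] -/
theorem classVariance_le_of_close (K : Finset ℕ) (u v ρ : ℕ → ℝ) {m : ℕ} {U M ε : ℝ}
    (hu : ∀ r, r < m → |∑ k ∈ K.filter (fun k : ℕ => k ≡ r [MOD m]), u k - ρ r * U| ≤ M)
    (hv : ∀ r, r < m → |∑ k ∈ K.filter (fun k : ℕ => k ≡ r [MOD m]), v k - ρ r * U| ≤ ε * U) :
    ∑ r ∈ range m, (∑ k ∈ K.filter (fun k : ℕ => k ≡ r [MOD m]), (u k - v k)) ^ 2 ≤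
      m * (2 * M ^ 2 + 2 * ε ^ 2 * U ^ 2) := by
  have hterm : ∀ r ∈ range m, (∑ k ∈ K.filter (fun k : ℕ => k ≡ r [MOD m]), (u k - v k)) ^ 2 ≤
      2 * M ^ 2 + 2 * ε ^ 2 * U ^ 2 := by
    intro r hr
    have hr' := mem_range.mp hr
    rw [sum_sub_distrib]
    have h1 := abs_le.mp (hu r hr')
    have h2 := abs_le.mp (hv r hr')
    set a := ∑ k ∈ K.filter (fun k : ℕ => k ≡ r [MOD m]), u k
    set b := ∑ k ∈ K.filter (fun k : ℕ => k ≡ r [MOD m]), v k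
    have e : a - b = (a - ρ r * U) - (b - ρ r * U) := by ring
    rw [e]
    nlinarith [h1.1, h1.2, h2.1, h2.2, sq_nonneg ((a - ρ r * U) + (b - ρ r * U)), sq_nonneg (ε * U),
      sq_abs (ε * U)]
  calc _ ≤ ∑ _r ∈ range m, (2 * M ^ 2 + 2 * ε ^ 2 * U ^ 2) := sum_le_sum hterm
    _ = m * (2 * M ^ 2 + 2 * ε ^ 2 * U ^ 2) := by rw [sum_const, card_range, nsmul_eq_mul]

/-- **There are at most `Q` sets `t` of primes with `2∏_{p∈t} p ≤ Q`** (`t ↦ ∏t` is injective on sets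
of primes). [cite: HalberstamRichert1974, Ch. 2 §2 (sums over square-free d ≤ Q)] -/
theorem card_powerset_filter_two_mul_prod_le {S : Finset ℕ} (hS : ∀ p ∈ S, p.Prime) (Q : ℕ) :
    #{t ∈ S.powerset | 2 * ∏ p ∈ t, p ≤ Q} ≤ Q := by
  classical
  have hinj : Set.InjOn (fun t : Finset ℕ => 2 * ∏ p ∈ t, p)
      ↑(S.powerset.filter (fun t => 2 * ∏ p ∈ t, p ≤ Q)) := by
    intro t₁ ht₁ t₂ ht₂ h
    rw [mem_coe, mem_filter, mem_powerset] at ht₁ ht₂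
    have h' : ∏ p ∈ t₁, p = ∏ p ∈ t₂, p := by
      have := h; simp only at this; omega
    have h1 := Nat.primeFactors_prod fun p hp => hS p (ht₁.1 hp)
    have h2 := Nat.primeFactors_prod fun p hp => hS p (ht₂.1 hp)
    rw [← h1, ← h2, h']
  have hmaps : Set.MapsTo (fun t : Finset ℕ => 2 * ∏ p ∈ t, p)
      ↑(S.powerset.filter (fun t => 2 * ∏ p ∈ t, p ≤ Q)) ↑(Icc 1 Q) := by
    intro t ht
    rw [mem_coe, mem_filter, mem_powerset] at ht
    rw [mem_coe, mem_Icc]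
    refine ⟨?_, ht.2⟩
    have : 0 < ∏ p ∈ t, p := prod_pos fun p hp => (hS p (ht.1 hp)).pos
    show (1 : ℕ) ≤ 2 * ∏ p ∈ t, p
    omega
  calc #{t ∈ S.powerset | 2 * ∏ p ∈ t, p ≤ Q} ≤ #(Icc 1 Q) := card_le_card_of_injOn _ hmaps hinj
    _ = Q := by simp

/-! ### Facts on the modulus `m = 2∏_{p∈t} p` -/

/-- For `t` a set of odd primes below `z`: `2 ∉ t`, the members of `insert 2 t` are prime,
`∏_{p ∈ insert 2 t} p = 2∏_{p∈t} p`, and every prime factor of `2∏t` is `< z` once `z > 2`. [folklore] -/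
private theorem insert_two_facts {z : ℝ} {t : Finset ℕ} (ht : t ⊆ oddPrimesBelow z) :
    2 ∉ t ∧ (∀ p ∈ insert 2 t, p.Prime) ∧ (∏ p ∈ insert 2 t, p) = 2 * ∏ p ∈ t, p ∧
      #(insert 2 t) = #t + 1 := by
  have h2 : 2 ∉ t := fun h => (mem_oddPrimesBelow.mp (ht h)).1 rfl
  refine ⟨h2, fun p hp => ?_, prod_insert h2, card_insert_of_notMem h2⟩
  rcases mem_insert.mp hp with rfl | hp
  · exact Nat.prime_two
  · exact Nat.prime_of_mem_primesBelow (mem_oddPrimesBelow.mp (ht hp)).2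

/-- The prime factors of `2∏_{p∈t} p` lie below `z` (`t` odd primes below `z`, `z > 2`). [folklore] -/
private theorem primeFactors_lt_of_dvd {z : ℝ} {t : Finset ℕ} (ht : t ⊆ oddPrimesBelow z) (hz : 2 < z)
    (q : ℕ) (hq : q.Prime) (hqd : q ∣ 2 * ∏ p ∈ t, p) : (q : ℝ) < z := by
  obtain ⟨h2, hprime, hprod, -⟩ := insert_two_facts ht
  rw [← hprod] at hqd
  have hmem : q ∈ (∏ p ∈ insert 2 t, p).primeFactors :=
    Nat.mem_primeFactors.mpr ⟨hq, hqd, (prod_pos fun p hp => (hprime p hp).pos).ne'⟩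
  rw [Nat.primeFactors_prod hprime] at hmem
  rcases mem_insert.mp hmem with rfl | hmem
  · exact_mod_cast hz
  · have := (Nat.mem_primesBelow.mp (mem_oddPrimesBelow.mp (ht hmem)).2).1
    have h1 : (q : ℝ) + 1 ≤ (⌈z⌉₊ : ℕ) := by exact_mod_cast this
    have h2 : ((⌈z⌉₊ : ℕ) : ℝ) < z + 1 := Nat.ceil_lt_add_one (by linarith)
    linarith

/-- `ν_m(r) ≤ 3^{|t|+1} m` and `cw(m) ≤ 2^{|t|+1}` for `m = 2∏_{p∈t} p`. [cite: HeathBrownMoroz2004, Lemma 2.4 (i)] -/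
theorem classCount_weight_le {z : ℝ} {t : Finset ℕ} (ht : t ⊆ oddPrimesBelow z) (r : ℕ) :
    (cubicClassCount (2 * ∏ p ∈ t, p) r : ℝ) ≤ 3 ^ (#t + 1) * ((2 * ∏ p ∈ t, p : ℕ) : ℝ) ∧
      coprimeClassWeight (2 * ∏ p ∈ t, p) ≤ 2 ^ (#t + 1) := by
  obtain ⟨h2, hprime, hprod, hcard⟩ := insert_two_facts ht
  constructor
  · have h := cubicClassCount_prod_primes_le hprime r
    rw [hprod, hcard] at h
    exact_mod_cast h
  · have h := coprimeClassWeight_le_two_pow (2 * ∏ p ∈ t, p)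
    rw [← hprod, Nat.primeFactors_prod hprime, hcard] at h
    rwa [← hprod]

/-! ### Middle moduli: the weight side (Brun–Titchmarsh) -/

/-- **Middle moduli, weight side**: with the class Brun–Titchmarsh bound (tree `sum_hbWeight_modEq_le`,
constants `C_BT, L₀`), for `m = 2∏_{p∈t} p` with `m² ≤ L`, `L₀² ≤ L`, `L ≥ N^{1/12}`, `L ≤ 2Xη`,
`m ≤ N/6`, `N ≥ 2` and `κη²N ≤ U`:  `∑_{k ≤ N, k ≡ r (m)} f₃(k) ≤ (96 C_BT/κ) · U · 6^{|t|+1}/m`.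
[cite: HeathBrownMoroz2004, §3 (3.1)–(3.3) (Brun–Titchmarsh for the form in residue classes)] -/
theorem sum_hbWeight_modEq_le_mid {C_BT L₀ : ℝ}
    (hBT : ∀ (c : ℝ) (N d r : ℕ), 0 < d → Nat.Coprime r d → L₀ ≤ (hbSide c N : ℝ) / d →
      ∑ k ∈ (Icc 1 N).filter (fun k : ℕ => k ≡ r [MOD d]), hbWeight c N k ≤
        C_BT * ((N : ℝ) ^ ((1 : ℝ) / 3) * Real.log N) * cubicClassCount d r * coprimeClassWeight d *
          ((hbSide c N : ℝ) / d) ^ 2 / Real.log ((hbSide c N : ℝ) / d))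
    (hC_BT : 0 ≤ C_BT) {c κ z : ℝ} {N : ℕ} {t : Finset ℕ} (ht : t ⊆ oddPrimesBelow z) (hκ : 0 < κ)
    (hN : 2 ≤ N) (hU : κ * hbEta c N ^ 2 * N ≤ ∑ k ∈ Icc 1 N, hbWeight c N k)
    (hLη : (hbSide c N : ℝ) ≤ 2 * hbX N * hbEta c N)
    (hLN : (N : ℝ) ^ ((1 : ℝ) / 12) ≤ hbSide c N)
    (hm2 : (((2 * ∏ p ∈ t, p : ℕ) : ℝ)) ^ 2 ≤ hbSide c N) (hL₀ : L₀ ^ 2 ≤ (hbSide c N : ℝ))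
    (hmN : ((2 * ∏ p ∈ t, p : ℕ) : ℝ) ≤ (N : ℝ) / 6) (r : ℕ) :
    ∑ k ∈ (Icc 1 N).filter (fun k : ℕ => k ≡ r [MOD 2 * ∏ p ∈ t, p]), hbWeight c N k ≤
      96 * C_BT / κ * (∑ k ∈ Icc 1 N, hbWeight c N k) * 6 ^ (#t + 1) / ((2 * ∏ p ∈ t, p : ℕ) : ℝ) := by
  obtain ⟨h2t, hprime, hprod, hcard⟩ := insert_two_facts ht
  set m : ℕ := 2 * ∏ p ∈ t, p with hm
  set U : ℝ := ∑ k ∈ Icc 1 N, hbWeight c N k with hUdef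
  set L : ℝ := (hbSide c N : ℝ) with hL
  have hm0 : 0 < m := Nat.mul_pos two_pos (prod_pos fun p hp => (hprime p (mem_insert_of_mem hp)).pos)
  have hmR : (0 : ℝ) < m := by exact_mod_cast hm0
  have hm1 : (1 : ℝ) ≤ m := by exact_mod_cast hm0
  have hU0 : 0 ≤ U := sum_nonneg fun k _ => hbWeight_nonneg c N k
  have hRHS0 : 0 ≤ 96 * C_BT / κ * U * 6 ^ (#t + 1) / (m : ℝ) := by positivity
  by_cases hr : Nat.Coprime r m
  swap
  · rw [sum_hbWeight_modEq_eq_zero_of_not_coprime c hm0 hr hmN]; exact hRHS0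
  -- sizes: `L ≥ N^{1/12} ≥ 1`, `√L ≥ m`, `L/m ≥ √L ≥ L₀`
  have hN1 : (1 : ℝ) ≤ N := by exact_mod_cast (by omega : 1 ≤ N)
  have hN2 : (2 : ℝ) ≤ N := by exact_mod_cast hN
  have hN12 : (1 : ℝ) ≤ (N : ℝ) ^ ((1 : ℝ) / 12) := Real.one_le_rpow hN1 (by norm_num)
  have hL1 : 1 ≤ L := hN12.trans hLN
  have hL0 : 0 < L := by linarith
  have hmL : (m : ℝ) ≤ Real.sqrt L := by
    rw [← Real.sqrt_sq hmR.le]; exact Real.sqrt_le_sqrt hm2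
  have hsqrtL : Real.sqrt L ≤ L / m := by
    rw [le_div_iff₀ hmR]
    calc Real.sqrt L * m ≤ Real.sqrt L * Real.sqrt L := mul_le_mul_of_nonneg_left hmL (Real.sqrt_nonneg L)
      _ = L := Real.mul_self_sqrt hL0.le
  have hL₀' : L₀ ≤ L / m := by
    have : L₀ ≤ Real.sqrt L := by
      calc L₀ ≤ |L₀| := le_abs_self L₀
        _ = Real.sqrt (L₀ ^ 2) := (Real.sqrt_sq_eq_abs L₀).symm
        _ ≤ Real.sqrt L := Real.sqrt_le_sqrt hL₀
    exact this.trans hsqrtL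
  have hBT' := hBT c N m r hm0 hr hL₀'
  -- `log(L/m) ≥ log √L = (log L)/2 ≥ (log N)/24`
  have hlogN : 0 < Real.log N := Real.log_pos (by linarith)
  have hlogL : Real.log N / 12 ≤ Real.log L := by
    have := Real.log_le_log (by positivity) hLN
    rw [Real.log_rpow (by linarith)] at this
    linarith
  have hlogLm : Real.log N / 24 ≤ Real.log (L / m) := by
    have h1 : Real.log (Real.sqrt L) ≤ Real.log (L / m) :=
      Real.log_le_log (Real.sqrt_pos.mpr hL0) hsqrtL
    rw [Real.log_sqrt hL0.le] at h1
    linarith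
  have hlogLm0 : 0 < Real.log (L / m) := by
    have : 0 < Real.log N / 24 := by positivity
    linarith
  -- the Brun–Titchmarsh bound with `1/log(L/m) ≤ 24/log N`
  obtain ⟨hν, hcw⟩ := classCount_weight_le ht r
  have hν0 : (0 : ℝ) ≤ cubicClassCount m r := Nat.cast_nonneg _
  have hcw0 : 0 ≤ coprimeClassWeight m := le_trans zero_le_one (one_le_coprimeClassWeight m)
  have hN13 : 0 ≤ (N : ℝ) ^ ((1 : ℝ) / 3) := by positivity
  have step1 : C_BT * ((N : ℝ) ^ ((1 : ℝ) / 3) * Real.log N) * cubicClassCount m r * coprimeClassWeight m *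
        (L / m) ^ 2 / Real.log (L / m) ≤
      C_BT * ((N : ℝ) ^ ((1 : ℝ) / 3) * Real.log N) * cubicClassCount m r * coprimeClassWeight m *
        (L / m) ^ 2 / (Real.log N / 24) :=
    div_le_div_of_nonneg_left (by positivity) (by positivity) hlogLm
  -- `N^{1/3} L² ≤ 4 η² N` and `η² N ≤ U/κ`
  have hX : hbX N ≤ (N : ℝ) ^ ((1 : ℝ) / 3) := by
    unfold hbX
    exact Real.rpow_le_rpow (by positivity) (by linarith) (by norm_num)
  have hX0 : 0 ≤ hbX N := hbX_nonneg N
  have hNX2 : (N : ℝ) ^ ((1 : ℝ) / 3) * hbX N ^ 2 ≤ N := by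
    calc (N : ℝ) ^ ((1 : ℝ) / 3) * hbX N ^ 2 ≤ (N : ℝ) ^ ((1 : ℝ) / 3) * ((N : ℝ) ^ ((1 : ℝ) / 3)) ^ 2 :=
          mul_le_mul_of_nonneg_left (pow_le_pow_left₀ hX0 hX 2) hN13
      _ = ((N : ℝ) ^ ((1 : ℝ) / 3)) ^ (3 : ℕ) := by ring
      _ = N := by
          rw [← Real.rpow_natCast, ← Real.rpow_mul (by positivity)]; norm_num
  have hη0 : 0 ≤ hbX N * hbEta c N := by
    have : (0 : ℝ) ≤ hbSide c N := Nat.cast_nonneg _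
    linarith
  have hL2 : L ^ 2 ≤ 4 * hbX N ^ 2 * hbEta c N ^ 2 := by
    have := pow_le_pow_left₀ hL0.le hLη 2
    calc L ^ 2 ≤ (2 * hbX N * hbEta c N) ^ 2 := this
      _ = 4 * hbX N ^ 2 * hbEta c N ^ 2 := by ring
  have hNL2 : (N : ℝ) ^ ((1 : ℝ) / 3) * L ^ 2 ≤ 4 * U / κ := by
    calc (N : ℝ) ^ ((1 : ℝ) / 3) * L ^ 2 ≤ (N : ℝ) ^ ((1 : ℝ) / 3) * (4 * hbX N ^ 2 * hbEta c N ^ 2) :=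
          mul_le_mul_of_nonneg_left hL2 hN13
      _ = 4 * ((N : ℝ) ^ ((1 : ℝ) / 3) * hbX N ^ 2) * hbEta c N ^ 2 := by ring
      _ ≤ 4 * N * hbEta c N ^ 2 := by
          have := mul_le_mul_of_nonneg_right hNX2 (sq_nonneg (hbEta c N))
          linarith
      _ = 4 * (hbEta c N ^ 2 * N) := by ring
      _ ≤ 4 * (U / κ) := by
          refine mul_le_mul_of_nonneg_left ?_ (by norm_num)
          rw [le_div_iff₀ hκ]
          calc hbEta c N ^ 2 * N * κ = κ * hbEta c N ^ 2 * N := by ring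
            _ ≤ U := hU
      _ = 4 * U / κ := by ring
  -- assemble
  have step2 : C_BT * ((N : ℝ) ^ ((1 : ℝ) / 3) * Real.log N) * cubicClassCount m r * coprimeClassWeight m *
        (L / m) ^ 2 / (Real.log N / 24) =
      24 * C_BT * (cubicClassCount m r * coprimeClassWeight m) * ((N : ℝ) ^ ((1 : ℝ) / 3) * L ^ 2) / (m : ℝ) ^ 2 := by
    field_simp
  have step3 : 24 * C_BT * (cubicClassCount m r * coprimeClassWeight m) *
        ((N : ℝ) ^ ((1 : ℝ) / 3) * L ^ 2) / (m : ℝ) ^ 2 ≤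
      24 * C_BT * (3 ^ (#t + 1) * (m : ℝ) * 2 ^ (#t + 1)) * (4 * U / κ) / (m : ℝ) ^ 2 := by
    refine div_le_div_of_nonneg_right ?_ (by positivity)
    refine mul_le_mul (mul_le_mul_of_nonneg_left (mul_le_mul hν hcw hcw0 (by positivity)) (by positivity))
      hNL2 (by positivity) (by positivity)
  have step4 : 24 * C_BT * (3 ^ (#t + 1) * (m : ℝ) * 2 ^ (#t + 1)) * (4 * U / κ) / (m : ℝ) ^ 2 =
      96 * C_BT / κ * U * 6 ^ (#t + 1) / (m : ℝ) := by
    rw [show (6 : ℝ) ^ (#t + 1) = 3 ^ (#t + 1) * 2 ^ (#t + 1) by rw [← mul_pow]; norm_num]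
    field_simp
    ring
  calc _ ≤ _ := hBT'
    _ ≤ _ := step1
    _ = _ := step2
    _ ≤ _ := step3
    _ = _ := step4

/-! ### Middle moduli: the model side (class sieve) -/

/-- **Middle moduli, model side**: with the class sieve in ratio form at `θ = 1` (tree
`exists_classRough_ratio_le`, constants `K₁, C₁`), for `m = 2∏_{p∈t} p` (`t` odd primes below `z > 2`)
with `C₁ z^{K₁} ≤ L/m`, `R ≥ L² V(z)/2`, `L ≥ 1`, `U ≥ 0` and all box values in `[1, N]`:
`∑_{k ≤ N, k≡r (m)} ũ(k) ≤ 4U · 6^{|t|+1}/m`.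
[cite: HalberstamRichert1974, Thm 2.5 (Fundamental Lemma, upper bound for the class counts)] -/
theorem sum_boxModel_modEq_le_mid {C₁ : ℝ} {K₁ : ℕ}
    (hratio : ∀ (A A' L d a b : ℕ) (z : ℝ), 0 < d → Nat.Coprime (a ^ 3 + 2 * b ^ 3) d → 3 ≤ z →
      C₁ * z ^ K₁ ≤ (L : ℝ) / d →
      |(#{xy ∈ classBoxPairs A A' L d a b | (xy.1 ^ 3 + 2 * xy.2 ^ 3).Coprime (primesProdBelow z)} : ℝ) -
          ((L : ℝ) / d) ^ 2 * classSieveProduct d z| ≤ 1 * (((L : ℝ) / d) ^ 2 * classSieveProduct d z))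
    {A L N : ℕ} {z U : ℝ} {t : Finset ℕ} (ht : t ⊆ oddPrimesBelow z) (hz3 : 3 ≤ z) (hU : 0 ≤ U)
    (hL : 1 ≤ L) (hval : ∀ xy ∈ Ioc A (A + L) ×ˢ Ioc A (A + L), xy.1 ^ 3 + 2 * xy.2 ^ 3 ∈ Icc 1 N)
    (hgrowth : C₁ * z ^ K₁ ≤ (L : ℝ) / ((2 * ∏ p ∈ t, p : ℕ) : ℝ))
    (hR : (L : ℝ) ^ 2 * oneClassProduct z / 2 ≤
      #{xy ∈ Ioc A (A + L) ×ˢ Ioc A (A + L) | (xy.1 ^ 3 + 2 * xy.2 ^ 3).Coprime (primesProdBelow z)})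
    (r : ℕ) :
    ∑ k ∈ (Icc 1 N).filter (fun k : ℕ => k ≡ r [MOD 2 * ∏ p ∈ t, p]),
        U / (#{xy ∈ Ioc A (A + L) ×ˢ Ioc A (A + L) |
            (xy.1 ^ 3 + 2 * xy.2 ^ 3).Coprime (primesProdBelow z)} : ℝ) *
          (#{xy ∈ Ioc A (A + L) ×ˢ Ioc A (A + L) |
            xy.1 ^ 3 + 2 * xy.2 ^ 3 = k ∧ Nat.Coprime k (primesProdBelow z)} : ℝ) ≤
      4 * U * 6 ^ (#t + 1) / ((2 * ∏ p ∈ t, p : ℕ) : ℝ) := by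
  classical
  obtain ⟨h2t, hprime, hprod, hcard⟩ := insert_two_facts ht
  have hz2 : (2 : ℝ) < z := by linarith
  have hm0 : 0 < 2 * ∏ p ∈ t, p :=
    Nat.mul_pos two_pos (prod_pos fun p hp => (hprime p (mem_insert_of_mem hp)).pos)
  have hmR : (0 : ℝ) < ((2 * ∏ p ∈ t, p : ℕ) : ℝ) := by exact_mod_cast hm0
  have hV0 : 0 < oneClassProduct z := oneClassProduct_pos z
  have hVm0 : 0 < classSieveProduct (2 * ∏ p ∈ t, p) z := classSieveProduct_pos _ z
  have hLR : (0 : ℝ) < L := by exact_mod_cast hL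
  have hR0 : (0 : ℝ) < #{xy ∈ Ioc A (A + L) ×ˢ Ioc A (A + L) |
      (xy.1 ^ 3 + 2 * xy.2 ^ 3).Coprime (primesProdBelow z)} :=
    lt_of_lt_of_le (div_pos (mul_pos (pow_pos hLR 2) hV0) two_pos) hR
  rw [sum_boxModel_filter_eq _ U _ (primesProdBelow z) (2 * ∏ p ∈ t, p) r hval]
  -- the class count `n_r ≤ ν_m(r) · 2 (L/m)² V_m`
  have hT0 : 0 ≤ ((L : ℝ) / ((2 * ∏ p ∈ t, p : ℕ) : ℝ)) ^ 2 * classSieveProduct (2 * ∏ p ∈ t, p) z :=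
    mul_nonneg (sq_nonneg _) hVm0.le
  have hclass : ∀ ab ∈ (range (2 * ∏ p ∈ t, p) ×ˢ range (2 * ∏ p ∈ t, p)).filter
      (fun ab : ℕ × ℕ => ab.1 ^ 3 + 2 * ab.2 ^ 3 ≡ r [MOD 2 * ∏ p ∈ t, p]),
      (#{xy ∈ classBoxPairs A A L (2 * ∏ p ∈ t, p) ab.1 ab.2 |
          (xy.1 ^ 3 + 2 * xy.2 ^ 3).Coprime (primesProdBelow z)} : ℝ) ≤
        2 * (((L : ℝ) / ((2 * ∏ p ∈ t, p : ℕ) : ℝ)) ^ 2 * classSieveProduct (2 * ∏ p ∈ t, p) z) := by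
    intro ab _
    by_cases hab : Nat.Coprime (ab.1 ^ 3 + 2 * ab.2 ^ 3) (2 * ∏ p ∈ t, p)
    · have h := abs_le.mp (hratio A A L (2 * ∏ p ∈ t, p) ab.1 ab.2 z hm0 hab hz3 hgrowth)
      linarith [h.2]
    · rw [card_classBoxPairs_rough_eq_zero hab (primeFactors_lt_of_dvd ht hz2), Nat.cast_zero]
      linarith
  have hn : (#{xy ∈ Ioc A (A + L) ×ˢ Ioc A (A + L) | xy.1 ^ 3 + 2 * xy.2 ^ 3 ≡ r [MOD 2 * ∏ p ∈ t, p] ∧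
      (xy.1 ^ 3 + 2 * xy.2 ^ 3).Coprime (primesProdBelow z)} : ℝ) ≤
      cubicClassCount (2 * ∏ p ∈ t, p) r *
        (2 * (((L : ℝ) / ((2 * ∏ p ∈ t, p : ℕ) : ℝ)) ^ 2 * classSieveProduct (2 * ∏ p ∈ t, p) z)) := by
    rw [card_box_modEq_rough_eq_sum hm0, Nat.cast_sum]
    refine (sum_le_sum hclass).trans ?_
    rw [sum_const, nsmul_eq_mul, cubicClassCount]
  obtain ⟨hν, -⟩ := classCount_weight_le ht r
  have hpf : (2 * ∏ p ∈ t, p).primeFactors = insert 2 t := by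
    rw [← hprod]; exact Nat.primeFactors_prod hprime
  have hVm : classSieveProduct (2 * ∏ p ∈ t, p) z ≤ (2 : ℝ) ^ (#t + 1) * oneClassProduct z := by
    have h := classSieveProduct_le_two_pow_mul hm0.ne' z
    rw [hpf, hcard] at h
    exact h
  have hn' : cubicClassCount (2 * ∏ p ∈ t, p) r *
        (2 * (((L : ℝ) / ((2 * ∏ p ∈ t, p : ℕ) : ℝ)) ^ 2 * classSieveProduct (2 * ∏ p ∈ t, p) z)) ≤
      2 * 6 ^ (#t + 1) * (L : ℝ) ^ 2 * oneClassProduct z / ((2 * ∏ p ∈ t, p : ℕ) : ℝ) := by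
    calc cubicClassCount (2 * ∏ p ∈ t, p) r *
          (2 * (((L : ℝ) / ((2 * ∏ p ∈ t, p : ℕ) : ℝ)) ^ 2 * classSieveProduct (2 * ∏ p ∈ t, p) z))
        ≤ (3 ^ (#t + 1) * ((2 * ∏ p ∈ t, p : ℕ) : ℝ)) *
            (2 * (((L : ℝ) / ((2 * ∏ p ∈ t, p : ℕ) : ℝ)) ^ 2 * ((2 : ℝ) ^ (#t + 1) * oneClassProduct z))) := by
          refine mul_le_mul hν (mul_le_mul_of_nonneg_left
            (mul_le_mul_of_nonneg_left hVm (sq_nonneg _)) (by norm_num)) ?_ (by positivity)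
          positivity
      _ = 2 * 6 ^ (#t + 1) * (L : ℝ) ^ 2 * oneClassProduct z / ((2 * ∏ p ∈ t, p : ℕ) : ℝ) := by
          rw [show (6 : ℝ) ^ (#t + 1) = 3 ^ (#t + 1) * 2 ^ (#t + 1) by rw [← mul_pow]; norm_num]
          field_simp
  -- divide by `R ≥ L² V/2`
  have hUR : U / (#{xy ∈ Ioc A (A + L) ×ˢ Ioc A (A + L) |
      (xy.1 ^ 3 + 2 * xy.2 ^ 3).Coprime (primesProdBelow z)} : ℝ) ≤
      2 * U / ((L : ℝ) ^ 2 * oneClassProduct z) := by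
    rw [div_le_div_iff₀ hR0 (by positivity)]
    calc U * ((L : ℝ) ^ 2 * oneClassProduct z) = 2 * U * ((L : ℝ) ^ 2 * oneClassProduct z / 2) := by ring
      _ ≤ 2 * U * _ := mul_le_mul_of_nonneg_left hR (by positivity)
  -- (`show`/`calc` against this goal triggers a pathological unification; go through `have`/`exact`)
  have hfinal : U / (#{xy ∈ Ioc A (A + L) ×ˢ Ioc A (A + L) |
        (xy.1 ^ 3 + 2 * xy.2 ^ 3).Coprime (primesProdBelow z)} : ℝ) *
        (#{xy ∈ Ioc A (A + L) ×ˢ Ioc A (A + L) | xy.1 ^ 3 + 2 * xy.2 ^ 3 ≡ r [MOD 2 * ∏ p ∈ t, p] ∧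
          (xy.1 ^ 3 + 2 * xy.2 ^ 3).Coprime (primesProdBelow z)} : ℝ) ≤
      4 * U * 6 ^ (#t + 1) / ((2 * ∏ p ∈ t, p : ℕ) : ℝ) := by
    refine (mul_le_mul hUR (hn.trans hn') (Nat.cast_nonneg _) (by positivity)).trans_eq ?_
    field_simp
    ring
  exact hfinal

/-! ### Large moduli: crude class counts -/

/-- **Large moduli, weight side**: for `m = 2∏_{p∈t} p` and `L = hbSide c N ≥ 1`,
`∑_{k ≤ N, k≡r (m)} f₃(k) ≤ N^{1/3} log N · L 3^{|t|+1} (L/m + 1)`.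
[cite: HeathBrownMoroz2004, §3 (3.1) (counting the form in residue classes)] -/
theorem sum_hbWeight_modEq_le_crude {c z : ℝ} {N : ℕ} {t : Finset ℕ} (ht : t ⊆ oddPrimesBelow z)
    (hL : 1 ≤ hbSide c N) (r : ℕ) :
    ∑ k ∈ (Icc 1 N).filter (fun k : ℕ => k ≡ r [MOD 2 * ∏ p ∈ t, p]), hbWeight c N k ≤
      (N : ℝ) ^ ((1 : ℝ) / 3) * Real.log N *
        ((hbSide c N : ℝ) * 3 ^ (#t + 1) * ((hbSide c N : ℝ) / ((2 * ∏ p ∈ t, p : ℕ) : ℝ) + 1)) := by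
  obtain ⟨h2t, hprime, hprod, hcard⟩ := insert_two_facts ht
  refine (sum_hbWeight_modEq_le_card c N _ r).trans ?_
  refine mul_le_mul_of_nonneg_left ?_ (mul_nonneg (by positivity) (Real.log_natCast_nonneg N))
  have hsub := primePairs_subset_box c N hL
  have h1 : (#{xy ∈ primePairs (hbX N) (hbEta c N) | xy.1 ^ 3 + 2 * xy.2 ^ 3 ≡ r [MOD 2 * ∏ p ∈ t, p]} : ℝ)
      ≤ #{xy ∈ Ioc ⌊hbX N⌋₊ (⌊hbX N⌋₊ + hbSide c N) ×ˢ Ioc ⌊hbX N⌋₊ (⌊hbX N⌋₊ + hbSide c N) |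
          xy.1 ^ 3 + 2 * xy.2 ^ 3 ≡ r [MOD 2 * ∏ p ∈ t, p]} := by
    exact_mod_cast card_le_card fun xy hxy => by
      rw [mem_filter] at hxy ⊢
      exact ⟨hsub hxy.1, hxy.2⟩
  have h2 := card_pairBox_modEq_le_of_prod_primes hprime ⌊hbX N⌋₊ ⌊hbX N⌋₊ (hbSide c N) r
  rw [hprod, hcard] at h2
  exact h1.trans h2

/-- **Large moduli, model side**: `∑_{k ≤ N, k≡r (m)} ũ(k) ≤ (U/R) · L 3^{|t|+1} (L/m + 1)` for
`m = 2∏_{p∈t} p`, `U, R ≥ 0`, all box values in `[1, N]`.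
[cite: HeathBrownMoroz2004, §3 (3.1) (counting the form in residue classes)] -/
theorem sum_boxModel_modEq_le_crude {A L N : ℕ} {z U R : ℝ} (P : ℕ) {t : Finset ℕ}
    (ht : t ⊆ oddPrimesBelow z) (hU : 0 ≤ U) (hR : 0 ≤ R)
    (hval : ∀ xy ∈ Ioc A (A + L) ×ˢ Ioc A (A + L), xy.1 ^ 3 + 2 * xy.2 ^ 3 ∈ Icc 1 N) (r : ℕ) :
    ∑ k ∈ (Icc 1 N).filter (fun k : ℕ => k ≡ r [MOD 2 * ∏ p ∈ t, p]),
        U / R * (#{xy ∈ Ioc A (A + L) ×ˢ Ioc A (A + L) | xy.1 ^ 3 + 2 * xy.2 ^ 3 = k ∧ Nat.Coprime k P} : ℝ) ≤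
      U / R * ((L : ℝ) * 3 ^ (#t + 1) * ((L : ℝ) / ((2 * ∏ p ∈ t, p : ℕ) : ℝ) + 1)) := by
  obtain ⟨h2t, hprime, hprod, hcard⟩ := insert_two_facts ht
  rw [sum_boxModel_filter_eq _ U R P _ r hval]
  refine mul_le_mul_of_nonneg_left ?_ (div_nonneg hU hR)
  have h1 : (#{xy ∈ Ioc A (A + L) ×ˢ Ioc A (A + L) | xy.1 ^ 3 + 2 * xy.2 ^ 3 ≡ r [MOD 2 * ∏ p ∈ t, p] ∧
      Nat.Coprime (xy.1 ^ 3 + 2 * xy.2 ^ 3) P} : ℝ) ≤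
      #{xy ∈ Ioc A (A + L) ×ˢ Ioc A (A + L) | xy.1 ^ 3 + 2 * xy.2 ^ 3 ≡ r [MOD 2 * ∏ p ∈ t, p]} := by
    exact_mod_cast card_le_card fun xy hxy => by
      rw [mem_filter] at hxy ⊢
      exact ⟨hxy.1, hxy.2.1⟩
  have h2 := card_pairBox_modEq_le_of_prod_primes hprime A A L r
  rw [hprod, hcard] at h2
  exact h1.trans h2

/-! ### Arithmetic of the weights `a_t = ∏_{p∈t}(p−2)⁻¹` -/

/-- `a_t · 6^{|t|+1}/(2∏t) = 3 ∏_{p∈t} 6/(p(p−2)) ≤ 3 ∏_{p∈t} 18/p²` (odd primes `p ≥ 3`).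
[cite: HalberstamRichert1974, Ch. 2 §2 (2.3)–(2.4) (sums of multiplicative weights over square-free d)] -/
theorem prod_inv_sub_two_mul_le {z : ℝ} {t : Finset ℕ} (ht : t ⊆ oddPrimesBelow z) :
    (∏ p ∈ t, (1 / ((p : ℝ) - 2))) * (6 : ℝ) ^ (#t + 1) / ((2 * ∏ p ∈ t, p : ℕ) : ℝ) ≤
      3 * ∏ p ∈ t, ((18 : ℝ) / (p : ℝ) ^ 2) := by
  have h3 : ∀ p ∈ t, (3 : ℝ) ≤ p := by
    intro p hp
    obtain ⟨hp2, hp'⟩ := mem_oddPrimesBelow.mp (ht hp)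
    have hpp := Nat.prime_of_mem_primesBelow hp'
    have : 3 ≤ p := by
      rcases hpp.eq_two_or_odd' with h | h
      · exact absurd h hp2
      · have := hpp.two_le; rcases h with ⟨k, hk⟩; omega
    exact_mod_cast this
  have hp0 : (∏ p ∈ t, (p : ℝ)) ≠ 0 :=
    prod_ne_zero_iff.mpr fun p hp => by have := h3 p hp; positivity
  have hp2 : (∏ p ∈ t, ((p : ℝ) - 2)) ≠ 0 :=
    prod_ne_zero_iff.mpr fun p hp => by have := h3 p hp; linarith
  have e1 : ∏ p ∈ t, (1 / ((p : ℝ) - 2)) = 1 / ∏ p ∈ t, ((p : ℝ) - 2) := by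
    rw [prod_div_distrib, prod_const_one]
  have e2 : ∏ p ∈ t, ((6 : ℝ) / ((p : ℝ) * ((p : ℝ) - 2))) =
      (6 : ℝ) ^ #t / ((∏ p ∈ t, (p : ℝ)) * ∏ p ∈ t, ((p : ℝ) - 2)) := by
    rw [prod_div_distrib, prod_mul_distrib, prod_const]
  have e : (∏ p ∈ t, (1 / ((p : ℝ) - 2))) * (6 : ℝ) ^ (#t + 1) / ((2 * ∏ p ∈ t, p : ℕ) : ℝ) =
      3 * ∏ p ∈ t, ((6 : ℝ) / ((p : ℝ) * ((p : ℝ) - 2))) := by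
    rw [e1, e2]
    push_cast
    field_simp
    ring
  rw [e]
  refine mul_le_mul_of_nonneg_left (prod_le_prod (fun p hp => ?_) fun p hp => ?_) (by norm_num)
  · have := h3 p hp
    exact div_nonneg (by norm_num) (mul_nonneg (by linarith) (by linarith))
  · have hp := h3 p hp
    rw [div_le_div_iff₀ (mul_pos (by linarith) (by linarith)) (by positivity)]
    nlinarith

/-- `a_t · 3^{|t|+1} = 3 ∏_{p∈t} 3/(p−2)` and **`∑_{t ⊆ S'} ∏_{p∈t} 3/(p−2) ≤ z³`** (`z ≥ 1`).
[cite: HalberstamRichert1974, Ch. 2 §2 (2.3)–(2.4) (sums of multiplicative weights over square-free d)] -/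
theorem sum_powerset_prod_three_div_le {z : ℝ} (hz : 1 ≤ z) :
    ∑ t ∈ (oddPrimesBelow z).powerset, ∏ p ∈ t, ((3 : ℝ) / ((p : ℝ) - 2)) ≤ z ^ 3 := by
  rw [← prod_one_add]
  exact prod_oddPrimesBelow_one_add_three_div_le hz

/-- `a_t 3^{|t|+1} = 3 ∏_{p∈t} 3/(p−2)`. [cite: HalberstamRichert1974, Ch. 2 §2 (2.3)–(2.4) (sums of multiplicative weights over square-free d)] -/
theorem prod_inv_sub_two_mul_three_pow (t : Finset ℕ) :
    (∏ p ∈ t, (1 / ((p : ℝ) - 2))) * (3 : ℝ) ^ (#t + 1) = 3 * ∏ p ∈ t, ((3 : ℝ) / ((p : ℝ) - 2)) := by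
  rw [pow_succ, ← prod_const, mul_comm ((∏ _p ∈ t, (3 : ℝ))) 3, ← mul_assoc, mul_comm _ (3 : ℝ),
    mul_assoc, ← prod_mul_distrib]
  congr 1
  exact prod_congr rfl fun p _ => by ring

end Literature.NumberTheory.Sieve.CubicMinorant

end
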